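import Summits.CriticalPhenomena.PercolationContinuityZ3.Theorems.PercNearOneGluingNoHeavyQuantSiblingStep
import HarnessLib

/-!
# QUANT lane R8, T-DEC: THE SIBLING STEP WITH GENUINELY COMPOSITE SIBLINGS (every sibling law has ≥ 3 atoms) —
# `LawDec.SiblingStepA ⟺ LawDec.SiblingStep`, so the node of record reads exactly as README V397 states the open core

builds on p205010 (kernel theorem, internal audit signed; external expert review pending)

Statement + support file (`--supports stmt-CriticalPhenomena-4575`), QUANT lane typer seat prim-quant-stmt (gen 39), rung R8 of
`run/shared/lean/prim/quant/LADDER.md`.  One inductive predicate (`LawDec.CompForestAN`), one `@[conjecture]` (`LawDec.SiblingStepA`);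
theorems with standard axioms, no sorries.  Continues typer g39's `…QuantSiblingStep` (✓ p396424: `CompForestN`, `BlobForest`, `SiblingStep`,
`sdec_lconv_blobForest`, `farTreeRow_of_siblingStep'`).

WHY.  `CompForestN` asks of each sibling `gate ρ q` only that the sub-forest law `ρ` be NOT A POINT MASS.  That still admits DISGUISED BLOBS:
`ρ = gate δ_K s` (two atoms `{0, K}`) gives the sibling law `gate ρ q = gate δ_K (q·s)` — a blob, which the slice theorem CW absorbs.  README
V397 states the open core as "a sibling group with ≥ 3 COMPOSITE (≥ 3-atom-law) members".  This file types that reading and proves it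
equivalent to `SiblingStep` in the kernel (so certificate families need only treat siblings with ≥ 3-atom laws):

* `LawDec.CompForestAN x n M μ k` — as `CompForestN`, but each sibling's sub-forest law `ρᵢ` (top `Mᵢ`, charged by `TreeBuiltN.top_pos`)
  charges SOME `h` with `1 ≤ h < Mᵢ`; equivalently the sibling law `gate ρᵢ qᵢ` has at least three atoms.
* `TreeBuiltN.mean_gt` (strict top-affordability `x·M < mean` for `M ≥ 1`), `treeBuiltN_point` (`δ_K` is tree-built with no gate at every
  floor), `eq_gate_point_of_twoAtom` (a law on `{0..M}` charging nothing in `[1, M)` is `gate δ_M (μ M)`), `lconv_right_comm`.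
* `CompForestN.partitionA` — every `CompForestN` forest is a `CompForestAN` forest (gate count `≤ n`) beside a `BlobForest` (the disguised
  blobs, re-read as `gate δ_{Mᵢ} (qᵢ·ρᵢ Mᵢ)` at a legal floor by `mean_gt`).
* **`@[conjecture] LawDec.SiblingStepA`** — `SiblingStep` restricted to `CompForestAN` forests (`k ≥ 3`).
* `sdec_compForestAN_of_siblingStepA` (widths 0/1/2 free, as in `…QuantSiblingStep`), **`siblingStep_of_siblingStepA : SiblingStepA → SiblingStep`**
  (partition; the genuine part by width / the node WITH THE SAME ORACLE — no gate decrease needed since `n_A ≤ n`; the disguised blobs by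
  `sdec_lconv_blobForest` fed with `gatedSliceMixLaw'_holds`), `siblingStepA_of_siblingStep`, **`siblingStepA_iff_siblingStep`**,
  **`Quant.farTreeRow_of_siblingStepA : LawDec.SiblingStepA → FarTreeRow`** (unconditional).

HONEST STATUS: `SiblingStepA` (⟺ `SiblingStep` ⟺ `GateStepN`), `FarTreeRow` OPEN; the RATE class log\* and the honest sentence of
`run/shared/lean/prim/quant/README.md` are unchanged.
[this work].  Nothing here is cited as a published result.  The gluing rows served [cite: KozmaNitzan2024, Conjecture 3 (p. 15)]; product
measure [cite: Grimmett1999, §1.3 p. 10].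
-/

noncomputable section

namespace Summit.CriticalPhenomena.PercolationContinuityZ3.Theorems
namespace Quant
namespace LawDec

open Finset

/-! ### Small law-level tools -/

/-- `(a ∗ b) ∗ c = (a ∗ c) ∗ b` with the top indices (from `lconv_assoc`, `lconv_comm`). [this work] -/
theorem lconv_right_comm (A B C : ℕ) (a b c : ℕ → ℝ) :
    lconv (A + B) C (lconv A B a b) c = lconv (A + C) B (lconv A C a c) b := by
  rw [← lconv_assoc A B C a b c, lconv_comm B C b c, Nat.add_comm B C, lconv_assoc A C B a c b]

/-- **`δ_K` is tree-built with no nontrivial gate at every floor in `(0,1)`** (`K` sure relays). [this work] -/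
theorem treeBuiltN_point (K : ℕ) {y : ℝ} (hy0 : 0 < y) (hy1 : y < 1) :
    TreeBuiltN y 0 K (fun h => if h = K then (1 : ℝ) else 0) := by
  induction K with
  | zero => exact TreeBuiltN.nil y hy0 hy1
  | succ K ih =>
    have hvK : ∀ h, K < h → (fun h => if h = K then (1 : ℝ) else 0) h = 0 := fun h hh => if_neg (by omega)
    have e : lconv K 1 (fun h => if h = K then (1 : ℝ) else 0) (fun h => if h = 1 then (1 : ℝ) else 0)
        = fun h => if h = K + 1 then (1 : ℝ) else 0 := by
      rw [lconv_relay_right K _ hvK]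
      funext h
      simp only [slice]
      by_cases h1 : 1 ≤ h
      · rw [if_pos h1]
        by_cases hK : h = K + 1
        · rw [if_pos hK, if_pos (show h - 1 = K by omega)]; ring
        · rw [if_neg hK, if_neg (show ¬ (h - 1 = K) by omega)]; ring
      · rw [if_neg h1, if_neg (show ¬ (h = K + 1) by omega)]; ring
    have := TreeBuiltN.conv ih (TreeBuiltN.relay y hy0 hy1)
    rwa [e] at this

/-- **strict top-affordability**: a tree-built law with `M ≥ 1` has `x·M < mean` (a relay has marginal `1 > x`; gates and sums preserve the
strict inequality). [this work] -/
theorem TreeBuiltN.mean_gt {x : ℝ} {n M : ℕ} {μ : ℕ → ℝ} (h : TreeBuiltN x n M μ) (hM : 1 ≤ M) :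
    x * (M : ℝ) < ∑ k ∈ Finset.range (M + 1), (k : ℝ) * μ k := by
  induction h with
  | nil x₀ hx0 hx1 => omega
  | relay x₀ hx0 hx1 => simp; linarith
  | @conv x₀ na nb Ma Mb a b ha hb iha ihb =>
    obtain ⟨hx0, _, _, _, a1, ata⟩ := ha.lawFacts
    obtain ⟨_, _, _, _, b1, bta⟩ := hb.lawFacts
    rw [sum_mul_lconv Ma Mb a b a1 b1, Nat.cast_add, mul_add]
    rcases Nat.eq_zero_or_pos Ma with hMa | hMa
    · subst hMa
      have := ihb (by omega)
      simp only [Nat.cast_zero, mul_zero] at ata ⊢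
      linarith
    · have := iha hMa
      linarith
  | @gate x₀ n₀ M₀ ρ q hq0 hq1 hρ ih =>
    rw [sum_mul_gate]
    have := ih hM
    nlinarith
  | @mono x₀ x'' n₀ M₀ μ₀ h hx''0 hxx ih =>
    have := ih hM
    have : x'' * (M₀ : ℝ) ≤ x₀ * (M₀ : ℝ) := mul_le_mul_of_nonneg_right hxx (Nat.cast_nonneg M₀)
    linarith

/-- **a probability law on `{0..M}` (`M ≥ 1`) charging no `h ∈ [1, M)` is the gated point mass `gate δ_M (μ M)`.** [this work] -/
theorem eq_gate_point_of_twoAtom {M : ℕ} {μ : ℕ → ℝ} (hM : 1 ≤ M) (hμM : ∀ h, M < h → μ h = 0)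
    (hμ1 : ∑ h ∈ Finset.range (M + 1), μ h = 1) (hno : ∀ h, 1 ≤ h → h < M → μ h = 0) :
    μ = gate (fun h => if h = M then (1 : ℝ) else 0) (μ M) := by
  -- mass: `μ 0 + μ M = 1`
  have hmass : μ 0 + μ M = 1 := by
    rw [← hμ1, Finset.sum_range_succ]
    congr 1
    rw [Finset.sum_eq_single 0]
    · intro h hh h0
      rw [Finset.mem_range] at hh
      exact hno h (Nat.one_le_iff_ne_zero.2 h0) hh
    · intro h0; exact absurd (Finset.mem_range.2 (by omega)) h0
  funext h
  simp only [LawDec.gate]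
  by_cases h0 : h = 0
  · subst h0; rw [if_neg (show ¬ (0 = M) by omega), if_pos rfl]; linarith
  · rw [if_neg h0]
    by_cases hM' : h = M
    · subst hM'; rw [if_pos rfl]; ring
    · rw [if_neg hM']
      rcases lt_or_gt_of_ne hM' with hlt | hgt
      · rw [hno h (Nat.one_le_iff_ne_zero.2 h0) hlt]; ring
      · rw [hμM h hgt]; ring

/-! ### Genuinely composite sibling forests -/

/-- **A forest of `k` GENUINELY COMPOSITE sibling trees at floor `x`**: as `CompForestN`, with each sibling's sub-forest law `ρᵢ` charging
some `h` with `1 ≤ h < Mᵢ` (so, the top being charged, the sibling law `gate ρᵢ qᵢ` has at least three atoms — README V397's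
"composite (≥ 3-atom-law) members"). [this work] -/
inductive CompForestAN : ℝ → ℕ → ℕ → (ℕ → ℝ) → ℕ → Prop
  | nil (x : ℝ) (hx0 : 0 < x) (hx1 : x < 1) : CompForestAN x 0 0 (fun h => if h = 0 then (1 : ℝ) else 0) 0
  | tree {x : ℝ} {n M k : ℕ} {μ : ℕ → ℝ} (hF : CompForestAN x n M μ k) {x₁ : ℝ} {n₁ M₁ : ℕ} {ρ : ℕ → ℝ}
      (q : ℝ) (hq0 : 0 < q) (hq1 : q < 1) (hxq : x ≤ q * x₁) (hρ : TreeBuiltN x₁ n₁ M₁ ρ)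
      (h3 : ∃ h : ℕ, 1 ≤ h ∧ h < M₁ ∧ 0 < ρ h) :
      CompForestAN x (n + (n₁ + 1)) (M + M₁) (lconv M M₁ μ (gate ρ q)) (k + 1)

/-- transport of a `CompForestAN` certificate along equal indices. [this work] -/
theorem CompForestAN.cast {x : ℝ} {n M k n' M' k' : ℕ} {μ μ' : ℕ → ℝ} (h : CompForestAN x n M μ k)
    (hn : n = n') (hM : M = M') (hμ : μ = μ') (hk : k = k') : CompForestAN x n' M' μ' k' := by
  subst hn hM hμ hk; exact h

/-- the floor of a genuinely composite forest lies in `(0,1)`. [this work] -/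
theorem CompForestAN.floor {x : ℝ} {n M k : ℕ} {μ : ℕ → ℝ} (h : CompForestAN x n M μ k) : 0 < x ∧ x < 1 := by
  induction h with
  | nil hx0 hx1 => exact ⟨hx0, hx1⟩
  | tree _ _ _ _ _ _ _ ih => exact ih

/-- a sub-forest law charging some `h < M` is not a point mass. [this work] -/
theorem ne_point_of_threeAtom {x₁ : ℝ} {n₁ M₁ : ℕ} {ρ : ℕ → ℝ} (hρ : TreeBuiltN x₁ n₁ M₁ ρ)
    (h3 : ∃ h : ℕ, 1 ≤ h ∧ h < M₁ ∧ 0 < ρ h) : ∀ K : ℕ, ρ ≠ fun h => if h = K then (1 : ℝ) else 0 := by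
  intro K hK
  obtain ⟨h, _, hhM, hh⟩ := h3
  have htop := hρ.top_pos
  rw [hK] at hh htop
  simp only at hh htop
  have h1 : h = K := by by_contra hne; rw [if_neg hne] at hh; exact lt_irrefl _ hh
  have h2 : M₁ = K := by by_contra hne; rw [if_neg hne] at htop; exact lt_irrefl _ htop
  omega

/-- **forgetting genuineness**: a `CompForestAN` forest is a `CompForestN` forest (same indices). [this work] -/
theorem CompForestAN.toCompForestN {x : ℝ} {n M k : ℕ} {μ : ℕ → ℝ} (h : CompForestAN x n M μ k) : CompForestN x n M μ k := by
  induction h with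
  | nil hx0 hx1 => exact CompForestN.nil x hx0 hx1
  | tree _ q hq0 hq1 hxq hρ h3 ih => exact CompForestN.tree ih q hq0 hq1 hxq hρ (ne_point_of_threeAtom hρ h3)

/-- a genuinely composite forest is tree-built. [this work] -/
theorem CompForestAN.treeBuiltN {x : ℝ} {n M k : ℕ} {μ : ℕ → ℝ} (h : CompForestAN x n M μ k) : TreeBuiltN x n M μ :=
  h.toCompForestN.treeBuiltN

/-- **PARTITION**: every `CompForestN` forest is a genuinely composite forest (gate count `≤ n`, at most as many siblings) beside a blob
forest (its disguised blobs). [this work] -/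
theorem CompForestN.partitionA {x : ℝ} {n M k : ℕ} {μ : ℕ → ℝ} (h : CompForestN x n M μ k) :
    ∃ (kA nA MA MB : ℕ) (μA μB : ℕ → ℝ), CompForestAN x nA MA μA kA ∧ BlobForest x MB μB ∧ nA ≤ n ∧ kA ≤ k ∧ M = MA + MB ∧
      μ = lconv MA MB μA μB := by
  induction h with
  | nil hx0 hx1 =>
    have hv0 : ∀ k, 0 < k → (fun h => if h = 0 then (1 : ℝ) else 0) k = 0 := fun k hk => if_neg (by omega)
    refine ⟨0, 0, 0, 0, _, _, CompForestAN.nil x hx0 hx1, BlobForest.nil x hx0 hx1, le_rfl, le_rfl, rfl, ?_⟩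
    exact funext fun k => (lconv_delta_left 0 0 _ hv0 k).symm
  | @tree n₀ M₀ k₀ μ₀ hF x₁ n₁ M₁ ρ q hq0 hq1 hxq hρ hnp ih =>
    obtain ⟨kA, nA, MA, MB, μA, μB, hA, hB, hn, hk, hM, hμ⟩ := ih
    subst hM; subst hμ
    obtain ⟨hx₁0, hx₁1, ρ0, ρM, ρ1, _⟩ := hρ.lawFacts
    by_cases h3 : ∃ h : ℕ, 1 ≤ h ∧ h < M₁ ∧ 0 < ρ h
    · -- a genuinely composite sibling: append it to the genuine part, `(μA ∗ μB) ∗ t = (μA ∗ t) ∗ μB`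
      refine ⟨kA + 1, nA + (n₁ + 1), MA + M₁, MB, _, _, CompForestAN.tree hA q hq0 hq1 hxq hρ h3, hB, by omega, by omega, by omega, ?_⟩
      exact lconv_right_comm MA MB M₁ μA μB (gate ρ q)
    · -- a disguised blob: `ρ = gate δ_{M₁} s`, `s = ρ M₁ ∈ (0,1]`, floor `x₁ < s`
      have hM₁ : 1 ≤ M₁ := by
        rcases Nat.eq_zero_or_pos M₁ with h0 | h0
        · exfalso
          subst h0
          refine hnp 0 (funext fun h => ?_)
          by_cases hh : h = 0
          · subst hh; rw [if_pos rfl]; simpa using ρ1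
          · rw [if_neg hh]; exact ρM h (Nat.pos_of_ne_zero hh)
        · exact h0
      have hno : ∀ h, 1 ≤ h → h < M₁ → ρ h = 0 :=
        fun h h1 hh => le_antisymm (not_lt.1 fun hpos => h3 ⟨h, h1, hh, hpos⟩) (ρ0 h)
      set s : ℝ := ρ M₁ with hs
      have hs0 : 0 < s := hρ.top_pos
      have hs1 : s ≤ 1 := by
        have := Finset.single_le_sum (fun h _ => ρ0 h) (Finset.mem_range.2 (Nat.lt_succ_self M₁))
        rw [ρ1] at this; exact this
      have hρeq : ρ = gate (fun h => if h = M₁ then (1 : ℝ) else 0) s := eq_gate_point_of_twoAtom hM₁ ρM ρ1 hno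
      -- strict top-affordability: `x₁·M₁ < mean ρ = s·M₁`, so `x₁ < s`
      have hmean : ∑ k ∈ Finset.range (M₁ + 1), (k : ℝ) * ρ k = s * (M₁ : ℝ) := by
        rw [hρeq, sum_mul_gate]
        simp
      have hx₁s : x₁ < s := by
        have := hρ.mean_gt hM₁
        rw [hmean] at this
        exact lt_of_mul_lt_mul_right this (Nat.cast_nonneg M₁)
      -- the blob `gate δ_{M₁} (q·s)` at floor `x`, inner floor `y = x₁/s < 1`
      have hy0 : 0 < x₁ / s := div_pos hx₁0 hs0
      have hy1 : x₁ / s < 1 := by rw [div_lt_one hs0]; exact hx₁s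
      have hpt : TreeBuiltN (x₁ / s) 0 M₁ (fun h => if h = M₁ then (1 : ℝ) else 0) := treeBuiltN_point M₁ hy0 hy1
      have hxq' : x ≤ q * s * (x₁ / s) := by
        rw [mul_assoc, mul_div_cancel₀ x₁ hs0.ne']; exact hxq
      have hB' := BlobForest.blob hB (q * s) (mul_pos hq0 hs0) (by nlinarith) hxq' hpt
      refine ⟨kA, nA, MA, MB + M₁, _, _, hA, hB', by omega, by omega, by omega, ?_⟩
      rw [hρeq, gate_gate]
      exact (lconv_assoc MA MB M₁ μA μB _).symm

/-! ### The node with genuinely composite siblings, and its equivalence with `SiblingStep` -/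

/-- **CONJECTURE (THE SIBLING STEP, GENUINELY COMPOSITE SIBLINGS; typer g39).**  `SiblingStep` restricted to forests of `k ≥ 3` siblings
`gate ρᵢ qᵢ` whose sub-forest laws charge some `h ∈ [1, Mᵢ)` — i.e. every sibling LAW HAS AT LEAST THREE ATOMS (README V397's wording of
the open core); equivalent to `SiblingStep` (`siblingStepA_iff_siblingStep`: disguised blobs are absorbed by the slice theorem CW), hence to
`GateStepN` / `GateStepNCore`, and sufficient for `Quant.FarTreeRow` (`farTreeRow_of_siblingStepA`).
builds on p205010 (kernel theorem, internal audit signed; external expert review pending). [this work] [status: open] -/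
@[conjecture] def SiblingStepA : Prop :=
  ∀ (x : ℝ) (n M k : ℕ) (μ : ℕ → ℝ), 3 ≤ k → CompForestAN x n M μ k →
    (∀ (x' : ℝ) (n' M' : ℕ) (μ' : ℕ → ℝ), n' < n → TreeBuiltN x' n' M' μ' → SDEC x' M' μ') →
    SDEC x M μ

/-- `SiblingStep ⟹ SiblingStepA` (forget genuineness). [this work] -/
theorem siblingStepA_of_siblingStep (hS : SiblingStep) : SiblingStepA :=
  fun x n M k μ hk hF hO => hS x n M k μ hk hF.toCompForestN hO

/-- **a genuinely composite forest is SDEC under the oracle below a budget `N ≥` its gate count** — widths 0/1/2 free (as in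
`sdec_compForestN_of_siblingStep`), width `≥ 3` THE NODE. [this work] -/
theorem sdec_compForestAN_of_siblingStepA (hS : SiblingStepA) (N : ℕ)
    (hO : ∀ (x' : ℝ) (n' M' : ℕ) (μ' : ℕ → ℝ), n' < N → TreeBuiltN x' n' M' μ' → SDEC x' M' μ')
    {x : ℝ} {n M k : ℕ} {μ : ℕ → ℝ} (hF : CompForestAN x n M μ k) (hn : n ≤ N) : SDEC x M μ := by
  have hF0 := hF
  cases hF with
  | nil _ _ =>
    intro q _ _ j' hj; omega
  | @tree n₀ M₀ k₀ μ₀ hF₁ x₁ n₁ M₁ ρ₁ q₁ hq₁0 hq₁1 hxq₁ hρ₁ _ =>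
    obtain ⟨hx₁0, hx₁1, _, _, _, _⟩ := hρ₁.lawFacts
    obtain ⟨_, _, _, hg₁M, _, _⟩ := (TreeBuiltN.gate q₁ hq₁0 hq₁1 hρ₁).lawFacts
    have hqx₁ : q₁ * x₁ < 1 := by nlinarith
    cases hF₁ with
    | nil hx0 _ =>
      have e : lconv 0 M₁ (fun h => if h = 0 then (1 : ℝ) else 0) (gate ρ₁ q₁) = gate ρ₁ q₁ :=
        funext fun h => lconv_delta_left 0 M₁ _ hg₁M h
      rw [e, Nat.zero_add]
      exact sdec_mono (sdec_gate (hO x₁ n₁ M₁ ρ₁ (by omega) hρ₁) q₁ hq₁0 hq₁1.le) hxq₁ hqx₁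
    | @tree n₀' M₀' k₀' μ₀' hF₂ x₂ n₂ M₂ ρ₂ q₂ hq₂0 hq₂1 hxq₂ hρ₂ _ =>
      obtain ⟨_, _, _, hg₂M, _, _⟩ := (TreeBuiltN.gate q₂ hq₂0 hq₂1 hρ₂).lawFacts
      cases hF₂ with
      | nil hx0 _ =>
        have e : lconv 0 M₂ (fun h => if h = 0 then (1 : ℝ) else 0) (gate ρ₂ q₂) = gate ρ₂ q₂ :=
          funext fun h => lconv_delta_left 0 M₂ _ hg₂M h
        rw [e, Nat.zero_add]
        have hxg : x < q₁ := lt_of_le_of_lt hxq₁ (by nlinarith)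
        have hc : TreeBuiltN (x / q₁) n₁ M₁ ρ₁ :=
          TreeBuiltN.mono hρ₁ (div_pos hx0 hq₁0) (by rw [div_le_iff₀ hq₁0]; linarith [mul_comm q₁ x₁])
        exact gateStepN_of_tree N x q₁ q₂ x₂ n₂ n₁ M₂ M₁ ρ₂ ρ₁ hO (by omega) hx0 hxg hq₁1 hq₂0 hq₂1 hxq₂ hρ₂ hc
      | tree _ _ _ _ _ _ _ =>
        exact hS x _ _ _ _ (by omega) hF0 (fun x' n' M' μ' hlt h' => hO x' n' M' μ' (by omega) h')

/-- **`SiblingStepA ⟹ SiblingStep`**: split off the disguised blobs (`partitionA`); the genuine part is SDEC by width or by the node with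
the SAME oracle (its gate count does not exceed `n`); the blobs are absorbed by `sdec_lconv_blobForest` (CW, `gatedSliceMixLaw'_holds`). [this work] -/
theorem siblingStep_of_siblingStepA (hS : SiblingStepA) : SiblingStep := by
  intro x n M k μ _ hF hO
  obtain ⟨kA, nA, MA, MB, μA, μB, hA, hB, hn, _, hM, hμ⟩ := hF.partitionA
  subst hM; subst hμ
  exact sdec_lconv_blobForest gatedSliceMixLaw'_holds hA.treeBuiltN (sdec_compForestAN_of_siblingStepA hS n hO hA hn) hB

/-- **`SiblingStepA ↔ SiblingStep`**. [this work] -/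
theorem siblingStepA_iff_siblingStep : SiblingStepA ↔ SiblingStep :=
  ⟨siblingStep_of_siblingStepA, siblingStepA_of_siblingStep⟩

/-- `SiblingStepA ↔ GateStepN`. [this work] -/
theorem siblingStepA_iff_gateStepN : SiblingStepA ↔ GateStepN :=
  siblingStepA_iff_siblingStep.trans siblingStep_iff_gateStepN

end LawDec

/-- **`SiblingStepA ⟹ Quant.FarTreeRow`, UNCONDITIONALLY** — the R8 tree row from the sibling step for forests of `k ≥ 3` siblings with
at least three atoms each. [this work] -/
theorem farTreeRow_of_siblingStepA (hS : LawDec.SiblingStepA) : FarTreeRow :=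
  farTreeRow_of_siblingStep' (LawDec.siblingStep_of_siblingStepA hS)

end Quant
end Summit.CriticalPhenomena.PercolationContinuityZ3.Theorems
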